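import Summits.QuantumFields.YangMills.Theorems.BalabanLadderUVSeamRecPolymerData
import Mathlib.Data.ZMod.Basic
import HarnessLib

/-!
# Crux `UVSeamRec` (stmt-QuantumFields-20043), lane B: g6's WINDOW COLOURING with ALL classes — every colour class of a window family of
# block-plaquettes is window-disjoint with a common torus window

Helper file (`--supports stmt-QuantumFields-20043`) of the width-lever seat `ym-20043-ceilings-p2` (lane B, gen 8).  g6's thinning lemma
`DLRPeeling.exists_windowDisjoint_subfamily` (p573746) colours a window family of level-`k` block-plaquettes by `K = 256(2m+4)⁴` colours and keeps
the LARGEST colour class; the sequel `…CeilingsDLRPeelingExpWeights` needs ALL classes (Hölder over the classes instead of thinning), so the colouring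
is re-proved here for EVERY class — same combinatorics:
* `card_windowColour` — the colour type (orientation, four bits, block index mod `2m+4`) has `256(2m+4)⁴` elements.
* `exists_windowColouring` — for a window family (blocks in `[o, o+2L+1)⁴`, torus holding the collar cube `(2m+1)b^k + 3 ≤ 2L+1`) there is a
  colouring every class of which has a common engine window `lo + [1, 2L−1−side]` and pairwise window-disjoint collar cubes (corner `b^k(y−m)`,
  side `(2m+1)b^k`).
HONEST FRAMING: lattice combinatorics only; nothing of E0′; not a gap, not Clay.  References: folklore.
-/

set_option autoImplicit false

noncomputable section

open Finset

namespace Summit.QuantumFields.YangMills.Cruxes.UVSeamRec.DLRPeeling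

open Summit.QuantumFields.YangMills.Cruxes.UVSeamRec.PolymerData

/-! ## §1 The window colouring: every colour class is window-disjoint and torus-fitting -/

section Colouring

/-- The number of colours is `256(2m+4)⁴`. [folklore] -/
theorem card_windowColour (m : ℕ) :
    haveI : NeZero (2 * m + 4) := ⟨by omega⟩
    Fintype.card (Fin 4 × Fin 4 × (Fin 4 → Bool) × (Fin 4 → ZMod (2 * m + 4))) = 256 * (2 * m + 4) ^ 4 := by
  haveI : NeZero (2 * m + 4) := ⟨by omega⟩
  simp only [Fintype.card_prod, Fintype.card_fin, Fintype.card_pi, Fintype.card_bool, Finset.prod_const,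
    Finset.card_univ, ZMod.card]
  ring

/-- **A WINDOW FAMILY HAS A COLOURING BY `256(2m+4)⁴` COLOURS ALL OF WHOSE CLASSES ARE WINDOW-DISJOINT WITH A COMMON TORUS WINDOW.**  A window
family `A` of level-`k` block-plaquettes on the odd torus `2L+1` (blocks in the period window `[o, o + 2L+1)⁴`), collar `m`, torus holding the
collar cube (`(2m+1)b^k + 3 ≤ 2L+1`): there is a colouring `col` of the block-plaquettes by (orientation, four bits, block index mod `2m+4`) such that
for EVERY colour `c₀` the members of `A` of colour `c₀` have (i) all collar cubes (corner `b^k(y − m)`, side `(2m+1)b^k`) inside ONE engine window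
`lo + [1, 2L − 1 − side]` and (ii) pairwise WINDOW-DISJOINT collar cubes (separated by a lattice layer in some coordinate).  This is g6's
`exists_windowDisjoint_subfamily` (p573746) for every colour class instead of the largest one; same colouring (the bits are `bulk/high` = whether
the collar cube based at the anchor fits below the top of the engine window), same proof. [folklore] -/
theorem exists_windowColouring (𝔟 : BlockSize) (m k L : ℕ) (hfit : (2 * m + 1) * 𝔟.b ^ k + 3 ≤ 2 * L + 1)
    (o : Fin 4 → ℤ) (A : Finset Polymer) (hA : ∀ γ ∈ A, γ.k = k)
    (hwin : ∀ γ ∈ A, ∀ c, o c ≤ anchor 𝔟 γ c ∧ anchor 𝔟 γ c + (𝔟.b : ℤ) ^ k ≤ o c + (2 * L + 1)) :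
    ∃ col : Polymer → Fin 4 × Fin 4 × (Fin 4 → Bool) × (Fin 4 → ZMod (2 * m + 4)),
      ∀ c₀ : Fin 4 × Fin 4 × (Fin 4 → Bool) × (Fin 4 → ZMod (2 * m + 4)), ∃ lo : Fin 4 → ℤ,
      (∀ γ ∈ A.filter (fun γ => col γ = c₀), ∀ j, lo j + 1 ≤ (𝔟.b : ℤ) ^ k * (γ.y j - m) ∧
        (𝔟.b : ℤ) ^ k * (γ.y j - m) + (((2 * m + 1) * 𝔟.b ^ k : ℕ) : ℤ) + 2 ≤ lo j + (2 * L + 1 : ℕ)) ∧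
      (∀ γ ∈ A.filter (fun γ => col γ = c₀), ∀ γ' ∈ A.filter (fun γ => col γ = c₀),
        γ ≠ γ' → ∃ j,
        (𝔟.b : ℤ) ^ k * (γ.y j - m) + (((2 * m + 1) * 𝔟.b ^ k : ℕ) : ℤ) + 1 ≤ (𝔟.b : ℤ) ^ k * (γ'.y j - m) ∨
        (𝔟.b : ℤ) ^ k * (γ'.y j - m) + (((2 * m + 1) * 𝔟.b ^ k : ℕ) : ℤ) + 1 ≤ (𝔟.b : ℤ) ^ k * (γ.y j - m)) := by
  classical
  haveI : NeZero (2 * m + 4) := ⟨by omega⟩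
  -- the colouring, in g6's letters
  let bulk : Polymer → Fin 4 → Bool := fun γ j =>
    decide (anchor 𝔟 γ j ≤ o j + 2 * L - ((2 * m + 1) * 𝔟.b ^ k : ℕ) - 2)
  let col : Polymer → Fin 4 × Fin 4 × (Fin 4 → Bool) × (Fin 4 → ZMod (2 * m + 4)) := fun γ =>
    (γ.μ, γ.ν, bulk γ, fun j => ((γ.y j : ℤ) : ZMod (2 * m + 4)))
  refine ⟨col, fun c₀ => ?_⟩
  set A' := A.filter fun a => col a = c₀ with hA'def
  have hA'A : A' ⊆ A := Finset.filter_subset _ _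
  have hcolA' : ∀ γ ∈ A', col γ = c₀ := fun γ hγ => (Finset.mem_filter.1 hγ).2
  -- basic sizes
  have hbk1 : (1 : ℤ) ≤ (𝔟.b : ℤ) ^ k := 𝔟.one_le_pow k
  have hside : (((2 * m + 1) * 𝔟.b ^ k : ℕ) : ℤ) = (2 * m + 1) * (𝔟.b : ℤ) ^ k := by push_cast; ring
  have hfit' : (2 * (m : ℤ) + 1) * (𝔟.b : ℤ) ^ k + 3 ≤ 2 * L + 1 := by exact_mod_cast hfit
  -- two anchors in the high strip with congruent block coordinates coincide
  have high_eq : ∀ γ ∈ A', ∀ γ' ∈ A', ∀ j, bulk γ j = false → anchor 𝔟 γ j = anchor 𝔟 γ' j := by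
    intro γ hγ γ' hγ' j hj
    have hγA := hA'A hγ
    have hγ'A := hA'A hγ'
    have hcc : col γ = col γ' := by rw [hcolA' γ hγ, hcolA' γ' hγ']
    have hbulk' : bulk γ' j = false := by
      have : (col γ).2.2.1 j = (col γ').2.2.1 j := by rw [hcc]
      simpa [col, hj] using this.symm
    have hmod : ((γ.y j : ℤ) : ZMod (2 * m + 4)) = ((γ'.y j : ℤ) : ZMod (2 * m + 4)) := by
      have : (col γ).2.2.2 j = (col γ').2.2.2 j := by rw [hcc]
      simpa [col] using this
    have hdvd : ((2 * m + 4 : ℕ) : ℤ) ∣ γ'.y j - γ.y j := (ZMod.intCast_eq_intCast_iff_dvd_sub _ _ _).1 hmod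
    have h1 : ¬ (anchor 𝔟 γ j ≤ o j + 2 * L - ((2 * m + 1) * 𝔟.b ^ k : ℕ) - 2) := by
      simpa [bulk] using hj
    have h2 : ¬ (anchor 𝔟 γ' j ≤ o j + 2 * L - ((2 * m + 1) * 𝔟.b ^ k : ℕ) - 2) := by
      simpa [bulk] using hbulk'
    rw [hside] at h1 h2
    push Not at h1 h2
    have hw := (hwin γ hγA j).2
    have hw' := (hwin γ' hγ'A j).2
    have hk := hA γ hγA
    have hk' := hA γ' hγ'A
    simp only [anchor, hk, hk'] at h1 h2 hw hw' ⊢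
    have hlt : |γ'.y j - γ.y j| < (2 * m + 4 : ℕ) := by
      rw [abs_lt]
      push_cast
      constructor
      · by_contra hcon
        push Not at hcon
        have : (𝔟.b : ℤ) ^ k * (γ'.y j - γ.y j) ≤ (𝔟.b : ℤ) ^ k * (-(2 * (m : ℤ) + 4)) :=
          mul_le_mul_of_nonneg_left hcon (by linarith)
        nlinarith
      · by_contra hcon
        push Not at hcon
        have : (𝔟.b : ℤ) ^ k * (2 * (m : ℤ) + 4) ≤ (𝔟.b : ℤ) ^ k * (γ'.y j - γ.y j) :=
          mul_le_mul_of_nonneg_left hcon (by linarith)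
        nlinarith
    have h0 : γ'.y j - γ.y j = 0 := Int.eq_zero_of_abs_lt_dvd hdvd (by exact_mod_cast hlt)
    rw [show γ'.y j = γ.y j by linarith]
  -- the common window
  rcases A'.eq_empty_or_nonempty with hA'e | ⟨γ₀, hγ₀⟩
  · refine ⟨fun _ => 0, ?_, ?_⟩ <;> simp [hA'e]
  refine ⟨fun j => (if bulk γ₀ j then o j else anchor 𝔟 γ₀ j) - m * (𝔟.b : ℤ) ^ k - 1, ?_, ?_⟩
  · intro γ hγ j
    have hγA := hA'A hγ
    have hk := hA γ hγA
    have hw := hwin γ hγA j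
    have hcc : bulk γ j = bulk γ₀ j := by
      have : (col γ).2.2.1 j = (col γ₀).2.2.1 j := by rw [hcolA' γ hγ, hcolA' γ₀ hγ₀]
      simpa [col] using this
    rw [hside]
    push_cast
    have e2 : (𝔟.b : ℤ) ^ k * (γ.y j - m) = (𝔟.b : ℤ) ^ k * γ.y j - (m : ℤ) * (𝔟.b : ℤ) ^ k := by ring
    rw [e2]
    cases hb : bulk γ₀ j
    · -- high coordinate: the anchor is the common one
      simp only [Bool.false_eq_true, if_false]
      have heq := high_eq γ hγ γ₀ hγ₀ j (hcc.trans hb)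
      rw [← heq]
      simp only [anchor, hk]
      constructor
      · linarith
      · linarith
    · -- bulk coordinate
      simp only [if_true]
      have hbulk : anchor 𝔟 γ j ≤ o j + 2 * L - ((2 * m + 1) * 𝔟.b ^ k : ℕ) - 2 := by
        have : bulk γ j = true := hcc.trans hb
        simpa [bulk] using this
      rw [hside] at hbulk
      simp only [anchor, hk] at hw hbulk
      constructor
      · linarith [hw.1]
      · linarith [hw.2]
  · intro γ hγ γ' hγ' hne
    have hγA := hA'A hγ
    have hγ'A := hA'A hγ'
    have hcc : col γ = col γ' := by rw [hcolA' γ hγ, hcolA' γ' hγ']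
    have hμ : γ.μ = γ'.μ := by have := congrArg Prod.fst hcc; simpa [col] using this
    have hν : γ.ν = γ'.ν := by have := congrArg (fun t => t.2.1) hcc; simpa [col] using this
    have hk : γ.k = γ'.k := by rw [hA γ hγA, hA γ' hγ'A]
    -- distinct members of one colour class differ in some block coordinate
    have hy : ∃ j, γ.y j ≠ γ'.y j := by
      by_contra hcon
      push Not at hcon
      apply hne
      obtain ⟨k₁, y₁, μ₁, ν₁, h₁⟩ := γ
      obtain ⟨k₂, y₂, μ₂, ν₂, h₂⟩ := γ'
      simp only at hk hμ hν hcon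
      subst hk; subst hμ; subst hν
      have : y₁ = y₂ := funext hcon
      subst this
      rfl
    obtain ⟨j, hj⟩ := hy
    have hmod : ((γ.y j : ℤ) : ZMod (2 * m + 4)) = ((γ'.y j : ℤ) : ZMod (2 * m + 4)) := by
      have : (col γ).2.2.2 j = (col γ').2.2.2 j := by rw [hcc]
      simpa [col] using this
    have hdvd : ((2 * m + 4 : ℕ) : ℤ) ∣ γ'.y j - γ.y j := (ZMod.intCast_eq_intCast_iff_dvd_sub _ _ _).1 hmod
    obtain ⟨q, hq⟩ := hdvd
    refine ⟨j, ?_⟩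
    rw [hside]
    rcases lt_trichotomy q 0 with hq0 | hq0 | hq0
    · right
      have hq1 : q ≤ -1 := by omega
      have : γ'.y j - γ.y j ≤ -((2 * m + 4 : ℕ) : ℤ) := by rw [hq]; push_cast; nlinarith
      push_cast at this
      nlinarith
    · exact absurd (by rw [hq0, mul_zero, sub_eq_zero] at hq; exact hq.symm) hj
    · left
      have hq1 : 1 ≤ q := by omega
      have : ((2 * m + 4 : ℕ) : ℤ) ≤ γ'.y j - γ.y j := by rw [hq]; push_cast; nlinarith
      push_cast at this
      nlinarith

end Colouring

end Summit.QuantumFields.YangMills.Cruxes.UVSeamRec.DLRPeeling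

end
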